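import Literature.Probability.RandomPlanarGeometry.SAWPulledExtensionStaircaseZ2
import HarnessLib

/-!
# Certified large-deviation rates for bridge spans on `ℤ²` (uniform bridges and the pulled law at `y = 2`)

Topic `Literature/Probability/RandomPlanarGeometry` (continues `SAWPulledMeanExtension.lean` — the Chernoff lemmas
`Zd.bridge_span_tail_le_exp`, `ExpTilt.sum_filter_ge_le/le_le` — and the certified windows of
`SAWPulledExtensionStaircaseZ2.lean`). Computational edition (the windows rest on declared `native_decide` certificates).

§1 (R48 «LD-SPAN») Uniform `n`-step bridges: `#{span ≥ v n} ≤ K(v)^n` for all `n ≥ 1`, with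
`(v, K) = (2/5, 2.596), (1/2, 2.515), (3/5, 2.378), (7/10, 2.160), (4/5, 1.885), (9/10, 1.641)`; since
`b_n ≥ e^{-c√n} μ^n` and `μ ≥ 2.604` (`le_connectiveConstant_2604`), these are explicit exponential rates
`0.003, 0.035, 0.091, 0.187, 0.323, 0.462` — the row `v = 2/5 < 1/2` is a CERTIFIED NON-BALLISTICITY of uniform bridges
on `ℤ²` with a rate (Duminil-Copin–Hammond (2013) / Hutchcroft (2018) give decay for every `v > 0` with no rate; nothing
certified is possible below `v ≈ 0.383` without an effective version of their theorem, `SAWPulledMeanExtension` §3).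
§2 (R49 «SPAN-CONCENTRATION») The pulled law `P^{B,2}_N ∝ 2^{span}`: for EVERY `N`,
`P^{B,2}_N(span ≥ 0.7 N) ≤ C·0.975^N` and `P^{B,2}_N(span ≤ 0.45 N) ≤ C·0.973^N` (`C = 2⁴¹/κ` from the all-`N`
enclosures); compare the eventual mean window `[15/26, 16/25]` of `forceExtension_two`.
Lane «pcv-sawmu», a-idea-1 gen 10, 2026-08-22. [cite: Beaton2015, §2, Theorem 1; DuminilCopinHammond2013, §2.4]
-/

noncomputable section

open Finset Filter Topology Literature.Probability.LatticeModels
open Literature.Probability.RandomPlanarGeometry.SAW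
open scoped BigOperators

namespace Literature.Probability.RandomPlanarGeometry.SAW.Zd

/-- **Large-deviation rate for the span of uniform bridges at `v = 2/5`** (`ℤ²`, all `n ≥ 1`):
`#{ω ∈ SAB_n : span ω ≥ (2/5) n} ≤ 2.596^n`, while `b_n ≥ e^{-c√n} μ^n` with `μ ≥ 2.604`: an explicit exponential
rate `log(2.604/2.596) = 0.0031` (Chernoff at the force `y = 11/9` with the certified window `λ_B(11/9) ≤ log U`, certificate
`(U/2.596)^5 ≤ (11/9)^2`). DC–H / Hutchcroft give such decay for every `v > 0` without a rate.
[cite: Beaton2015, §2; DuminilCopinHammond2013, §2.4] -/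
theorem bridge_span_tail_twoFifths {n : ℕ} (hn : 1 ≤ n) :
    ((((bridges 2 n).filter fun ω => (2 : ℝ) / 5 * (n : ℝ) ≤ ((ω n 0 : ℤ) : ℝ)).card : ℝ)) ≤ ((2596 : ℝ) / 1000) ^ n := by
  have h := bridge_span_tail_le_exp 1 ((2 : ℝ) / 5) (s := Real.log ((11 : ℝ) / 9))
    (Real.log_nonneg (by norm_num)) hn
  rw [Real.exp_log (by norm_num : (0 : ℝ) < ((11 : ℝ) / 9))] at h
  refine h.trans ?_
  have hU := freeEnergyWindow_r11_9.2
  have hc : (5 : ℝ) * (Real.log ((278379899 : ℝ) / 99000000) - Real.log ((2596 : ℝ) / 1000)) ≤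
      2 * (Real.log ((11 : ℝ) / 9) - Real.log 1) := by
    exact_mod_cast log_cert_upper 2 5 (y₀ := 1) (z := ((11 : ℝ) / 9)) (L₀ := ((2596 : ℝ) / 1000))
      (Uz := ((278379899 : ℝ) / 99000000)) (by norm_num) (by norm_num) (by norm_num) (by norm_num) (by norm_num)
  rw [Real.log_one, sub_zero] at hc
  have hK : Real.exp ((n : ℝ) * Real.log ((2596 : ℝ) / 1000)) = ((2596 : ℝ) / 1000) ^ n := by
    rw [Real.exp_nat_mul, Real.exp_log (by norm_num)]
  rw [← hK, Real.exp_le_exp]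
  refine mul_le_mul_of_nonneg_left ?_ (Nat.cast_nonneg n)
  linarith

/-- **Large-deviation rate for the span of uniform bridges at `v = 1/2`** (`ℤ²`, all `n ≥ 1`):
`#{ω ∈ SAB_n : span ω ≥ (1/2) n} ≤ 2.515^n`, while `b_n ≥ e^{-c√n} μ^n` with `μ ≥ 2.604`: an explicit exponential
rate `log(2.604/2.515) = 0.0348` (Chernoff at the force `y = 3/2` with the certified window `λ_B(3/2) ≤ log U`, certificate
`(U/2.515)^2 ≤ (3/2)^1`). DC–H / Hutchcroft give such decay for every `v > 0` without a rate.
[cite: Beaton2015, §2; DuminilCopinHammond2013, §2.4] -/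
theorem bridge_span_tail_half {n : ℕ} (hn : 1 ≤ n) :
    ((((bridges 2 n).filter fun ω => (1 : ℝ) / 2 * (n : ℝ) ≤ ((ω n 0 : ℤ) : ℝ)).card : ℝ)) ≤ ((2515 : ℝ) / 1000) ^ n := by
  have h := bridge_span_tail_le_exp 1 ((1 : ℝ) / 2) (s := Real.log ((3 : ℝ) / 2))
    (Real.log_nonneg (by norm_num)) hn
  rw [Real.exp_log (by norm_num : (0 : ℝ) < ((3 : ℝ) / 2))] at h
  refine h.trans ?_
  have hU := freeEnergyWindow_r3_2.2
  have hc : (2 : ℝ) * (Real.log ((18470750 : ℝ) / 6000000) - Real.log ((2515 : ℝ) / 1000)) ≤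
      1 * (Real.log ((3 : ℝ) / 2) - Real.log 1) := by
    exact_mod_cast log_cert_upper 1 2 (y₀ := 1) (z := ((3 : ℝ) / 2)) (L₀ := ((2515 : ℝ) / 1000))
      (Uz := ((18470750 : ℝ) / 6000000)) (by norm_num) (by norm_num) (by norm_num) (by norm_num) (by norm_num)
  rw [Real.log_one, sub_zero] at hc
  have hK : Real.exp ((n : ℝ) * Real.log ((2515 : ℝ) / 1000)) = ((2515 : ℝ) / 1000) ^ n := by
    rw [Real.exp_nat_mul, Real.exp_log (by norm_num)]
  rw [← hK, Real.exp_le_exp]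
  refine mul_le_mul_of_nonneg_left ?_ (Nat.cast_nonneg n)
  linarith

/-- **Large-deviation rate for the span of uniform bridges at `v = 3/5`** (`ℤ²`, all `n ≥ 1`):
`#{ω ∈ SAB_n : span ω ≥ (3/5) n} ≤ 2.378^n`, while `b_n ≥ e^{-c√n} μ^n` with `μ ≥ 2.604`: an explicit exponential
rate `log(2.604/2.378) = 0.0908` (Chernoff at the force `y = 2` with the certified window `λ_B(2) ≤ log U`, certificate
`(U/2.378)^5 ≤ (2)^3`). DC–H / Hutchcroft give such decay for every `v > 0` without a rate.
[cite: Beaton2015, §2; DuminilCopinHammond2013, §2.4] -/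
theorem bridge_span_tail_threeFifths {n : ℕ} (hn : 1 ≤ n) :
    ((((bridges 2 n).filter fun ω => (3 : ℝ) / 5 * (n : ℝ) ≤ ((ω n 0 : ℤ) : ℝ)).card : ℝ)) ≤ ((2378 : ℝ) / 1000) ^ n := by
  have h := bridge_span_tail_le_exp 1 ((3 : ℝ) / 5) (s := Real.log (2 : ℝ))
    (Real.log_nonneg (by norm_num)) hn
  rw [Real.exp_log (by norm_num : (0 : ℝ) < (2 : ℝ))] at h
  refine h.trans ?_
  have hU := freeEnergyWindow_two.2
  have hc : (5 : ℝ) * (Real.log ((7206013 : ℝ) / 2000000) - Real.log ((2378 : ℝ) / 1000)) ≤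
      3 * (Real.log (2 : ℝ) - Real.log 1) := by
    exact_mod_cast log_cert_upper 3 5 (y₀ := 1) (z := (2 : ℝ)) (L₀ := ((2378 : ℝ) / 1000))
      (Uz := ((7206013 : ℝ) / 2000000)) (by norm_num) (by norm_num) (by norm_num) (by norm_num) (by norm_num)
  rw [Real.log_one, sub_zero] at hc
  have hK : Real.exp ((n : ℝ) * Real.log ((2378 : ℝ) / 1000)) = ((2378 : ℝ) / 1000) ^ n := by
    rw [Real.exp_nat_mul, Real.exp_log (by norm_num)]
  rw [← hK, Real.exp_le_exp]
  refine mul_le_mul_of_nonneg_left ?_ (Nat.cast_nonneg n)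
  linarith

/-- **Large-deviation rate for the span of uniform bridges at `v = 7/10`** (`ℤ²`, all `n ≥ 1`):
`#{ω ∈ SAB_n : span ω ≥ (7/10) n} ≤ 2.16^n`, while `b_n ≥ e^{-c√n} μ^n` with `μ ≥ 2.604`: an explicit exponential
rate `log(2.604/2.16) = 0.1869` (Chernoff at the force `y = 256/81` with the certified window `λ_B(256/81) ≤ log U`, certificate
`(U/2.16)^10 ≤ (256/81)^7`). DC–H / Hutchcroft give such decay for every `v > 0` without a rate.
[cite: Beaton2015, §2; DuminilCopinHammond2013, §2.4] -/
theorem bridge_span_tail_sevenTenths {n : ℕ} (hn : 1 ≤ n) :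
    ((((bridges 2 n).filter fun ω => (7 : ℝ) / 10 * (n : ℝ) ≤ ((ω n 0 : ℤ) : ℝ)).card : ℝ)) ≤ ((2160 : ℝ) / 1000) ^ n := by
  have h := bridge_span_tail_le_exp 1 ((7 : ℝ) / 10) (s := Real.log ((256 : ℝ) / 81))
    (Real.log_nonneg (by norm_num)) hn
  rw [Real.exp_log (by norm_num : (0 : ℝ) < ((256 : ℝ) / 81))] at h
  refine h.trans ?_
  have hU := freeEnergyWindow_r256_81.2
  have hc : (10 : ℝ) * (Real.log ((100199329268 : ℝ) / 20736000000) - Real.log ((2160 : ℝ) / 1000)) ≤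
      7 * (Real.log ((256 : ℝ) / 81) - Real.log 1) := by
    exact_mod_cast log_cert_upper 7 10 (y₀ := 1) (z := ((256 : ℝ) / 81)) (L₀ := ((2160 : ℝ) / 1000))
      (Uz := ((100199329268 : ℝ) / 20736000000)) (by norm_num) (by norm_num) (by norm_num) (by norm_num) (by norm_num)
  rw [Real.log_one, sub_zero] at hc
  have hK : Real.exp ((n : ℝ) * Real.log ((2160 : ℝ) / 1000)) = ((2160 : ℝ) / 1000) ^ n := by
    rw [Real.exp_nat_mul, Real.exp_log (by norm_num)]
  rw [← hK, Real.exp_le_exp]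
  refine mul_le_mul_of_nonneg_left ?_ (Nat.cast_nonneg n)
  linarith

/-- **Large-deviation rate for the span of uniform bridges at `v = 4/5`** (`ℤ²`, all `n ≥ 1`):
`#{ω ∈ SAB_n : span ω ≥ (4/5) n} ≤ 1.885^n`, while `b_n ≥ e^{-c√n} μ^n` with `μ ≥ 2.604`: an explicit exponential
rate `log(2.604/1.885) = 0.3231` (Chernoff at the force `y = 4` with the certified window `λ_B(4) ≤ log U`, certificate
`(U/1.885)^5 ≤ (4)^4`). DC–H / Hutchcroft give such decay for every `v > 0` without a rate.
[cite: Beaton2015, §2; DuminilCopinHammond2013, §2.4] -/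
theorem bridge_span_tail_fourFifths {n : ℕ} (hn : 1 ≤ n) :
    ((((bridges 2 n).filter fun ω => (4 : ℝ) / 5 * (n : ℝ) ≤ ((ω n 0 : ℤ) : ℝ)).card : ℝ)) ≤ ((1885 : ℝ) / 1000) ^ n := by
  have h := bridge_span_tail_le_exp 1 ((4 : ℝ) / 5) (s := Real.log (4 : ℝ))
    (Real.log_nonneg (by norm_num)) hn
  rw [Real.exp_log (by norm_num : (0 : ℝ) < (4 : ℝ))] at h
  refine h.trans ?_
  have hU := freeEnergyWindow_four.2
  have hc : (5 : ℝ) * (Real.log ((22843177 : ℝ) / 4000000) - Real.log ((1885 : ℝ) / 1000)) ≤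
      4 * (Real.log (4 : ℝ) - Real.log 1) := by
    exact_mod_cast log_cert_upper 4 5 (y₀ := 1) (z := (4 : ℝ)) (L₀ := ((1885 : ℝ) / 1000))
      (Uz := ((22843177 : ℝ) / 4000000)) (by norm_num) (by norm_num) (by norm_num) (by norm_num) (by norm_num)
  rw [Real.log_one, sub_zero] at hc
  have hK : Real.exp ((n : ℝ) * Real.log ((1885 : ℝ) / 1000)) = ((1885 : ℝ) / 1000) ^ n := by
    rw [Real.exp_nat_mul, Real.exp_log (by norm_num)]
  rw [← hK, Real.exp_le_exp]
  refine mul_le_mul_of_nonneg_left ?_ (Nat.cast_nonneg n)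
  linarith

/-- **Large-deviation rate for the span of uniform bridges at `v = 9/10`** (`ℤ²`, all `n ≥ 1`):
`#{ω ∈ SAB_n : span ω ≥ (9/10) n} ≤ 1.641^n`, while `b_n ≥ e^{-c√n} μ^n` with `μ ≥ 2.604`: an explicit exponential
rate `log(2.604/1.641) = 0.4617` (Chernoff at the force `y = 4` with the certified window `λ_B(4) ≤ log U`, certificate
`(U/1.641)^10 ≤ (4)^9`). DC–H / Hutchcroft give such decay for every `v > 0` without a rate.
[cite: Beaton2015, §2; DuminilCopinHammond2013, §2.4] -/
theorem bridge_span_tail_nineTenths {n : ℕ} (hn : 1 ≤ n) :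
    ((((bridges 2 n).filter fun ω => (9 : ℝ) / 10 * (n : ℝ) ≤ ((ω n 0 : ℤ) : ℝ)).card : ℝ)) ≤ ((1641 : ℝ) / 1000) ^ n := by
  have h := bridge_span_tail_le_exp 1 ((9 : ℝ) / 10) (s := Real.log (4 : ℝ))
    (Real.log_nonneg (by norm_num)) hn
  rw [Real.exp_log (by norm_num : (0 : ℝ) < (4 : ℝ))] at h
  refine h.trans ?_
  have hU := freeEnergyWindow_four.2
  have hc : (10 : ℝ) * (Real.log ((22843177 : ℝ) / 4000000) - Real.log ((1641 : ℝ) / 1000)) ≤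
      9 * (Real.log (4 : ℝ) - Real.log 1) := by
    exact_mod_cast log_cert_upper 9 10 (y₀ := 1) (z := (4 : ℝ)) (L₀ := ((1641 : ℝ) / 1000))
      (Uz := ((22843177 : ℝ) / 4000000)) (by norm_num) (by norm_num) (by norm_num) (by norm_num) (by norm_num)
  rw [Real.log_one, sub_zero] at hc
  have hK : Real.exp ((n : ℝ) * Real.log ((1641 : ℝ) / 1000)) = ((1641 : ℝ) / 1000) ^ n := by
    rw [Real.exp_nat_mul, Real.exp_log (by norm_num)]
  rw [← hK, Real.exp_le_exp]
  refine mul_le_mul_of_nonneg_left ?_ (Nat.cast_nonneg n)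
  linarith

/-- The pulled weight of the spans `≥ u` resp. `≤ u` among `N`-step bridges at force `y`:
`Σ_{A ≥ u} β_{N,A} y^A` written over the span family (`A ∈ range (N+1)`). [cite: Beaton2015, §2 (B(x,y))] -/
theorem pulledMass_eq_sum_exp (N : ℕ) {y : ℝ} (hy : 0 < y) (P : ℕ → Prop) [DecidablePred P] :
    ∑ A ∈ (Finset.range (N + 1)).filter P, ((brSpan 2 N (A : ℤ)).card : ℝ) * y ^ A =
      ∑ A ∈ (Finset.range (N + 1)).filter P, ((brSpan 2 N (A : ℤ)).card : ℝ) * Real.exp ((A : ℝ) * Real.log y) := by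
  refine Finset.sum_congr rfl fun A _ => ?_
  rw [Real.exp_nat_mul, Real.exp_log hy]

/-- **Span concentration under the pulled law at `y = 2`, upper tail, every `N`** (`ℤ²`): there is `C > 0` with
`Σ_{A ≥ (7/10)N} β_{N,A} 2^A ≤ C · 0.975^N · Z^B_N(2)` for all `N`, i.e. `P^{B,2}_N(span ≥ 0.7 N) ≤ C e^{-0.0253 N}`
(Chernoff towards the force `3`: certificate `(U_3/(0.975 L_2))^10 ≤ (3/2)^7` with the all-`N` enclosures
`Z^B_N(3) ≤ 2⁴¹ U_3^N` (`driftZ_three_upper`) and `κ L_2^N ≤ Z^B_N(2)` (`pulledBridgeZ_two_lower_sharp`); `C = 2⁴¹/κ`).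
[cite: Beaton2015, §2 (B(x,y)), Theorem 1] -/
theorem pulled_two_upperTail :
    ∃ C : ℝ, 0 < C ∧ ∀ N : ℕ,
      ∑ A ∈ (Finset.range (N + 1)).filter (fun A : ℕ => (7 : ℝ) / 10 * (N : ℝ) ≤ (A : ℝ)),
          ((brSpan 2 N (A : ℤ)).card : ℝ) * (2 : ℝ) ^ A ≤
        C * ((975 : ℝ) / 1000) ^ N * pulledBridgeZ 2 N 2 := by
  obtain ⟨κ, hκ, hlow⟩ := pulledBridgeZ_two_lower_sharp
  refine ⟨2 ^ 41 / κ, by positivity, fun N => ?_⟩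
  have hst : Real.log 2 ≤ Real.log 3 := Real.log_le_log (by norm_num) (by norm_num)
  -- Chernoff in the span family
  have h1 := ExpTilt.sum_filter_ge_le (Finset.range (N + 1)) (w := fun A : ℕ => ((brSpan 2 N (A : ℤ)).card : ℝ))
    (fun _ _ => Nat.cast_nonneg _) (fun A : ℕ => (A : ℝ)) hst ((7 : ℝ) / 10 * (N : ℝ))
  rw [← pulledBridgeZ_exp_eq_tiltZ, Real.exp_log (by norm_num : (0 : ℝ) < 3)] at h1
  rw [pulledMass_eq_sum_exp N (by norm_num : (0 : ℝ) < 2)]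
  refine h1.trans ?_
  -- all-N enclosures
  have hZ3 : pulledBridgeZ 2 N 3 ≤ 2 ^ 41 * ((13989287 : ℝ) / 3000000) ^ N :=
    (pulledBridgeZ_le_driftZ 2 N (by norm_num)).trans (driftZ_three_upper N)
  have hZ2 := hlow N
  -- the certificate: 10·(log U₃ − log(ρ L₂)) ≤ 7·(log 3 − log 2)
  have hc : (10 : ℝ) * (Real.log ((13989287 : ℝ) / 3000000) - Real.log (((975 : ℝ) / 1000) * ((1250 : ℝ) / 347))) ≤
      7 * (Real.log 3 - Real.log 2) := by
    exact_mod_cast log_cert_upper 7 10 (y₀ := 2) (z := 3) (L₀ := ((975 : ℝ) / 1000) * ((1250 : ℝ) / 347))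
      (Uz := ((13989287 : ℝ) / 3000000)) (by norm_num) (by norm_num) (by norm_num) (by norm_num) (by norm_num)
  have hunit : Real.exp (-((Real.log 3 - Real.log 2) * ((7 : ℝ) / 10 * (N : ℝ)))) * ((13989287 : ℝ) / 3000000) ^ N ≤
      (((975 : ℝ) / 1000) * ((1250 : ℝ) / 347)) ^ N := by
    rw [← Real.exp_log (by norm_num : (0 : ℝ) < ((13989287 : ℝ) / 3000000)), ← Real.exp_nat_mul, ← Real.exp_add,
      ← Real.exp_log (by norm_num : (0 : ℝ) < ((975 : ℝ) / 1000) * ((1250 : ℝ) / 347)), ← Real.exp_nat_mul, Real.exp_le_exp]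
    have hN : (0 : ℝ) ≤ N := Nat.cast_nonneg N
    nlinarith
  have hρN : (0 : ℝ) ≤ ((975 : ℝ) / 1000) ^ N := by positivity
  calc Real.exp (-((Real.log 3 - Real.log 2) * ((7 : ℝ) / 10 * (N : ℝ)))) * pulledBridgeZ 2 N 3
      ≤ Real.exp (-((Real.log 3 - Real.log 2) * ((7 : ℝ) / 10 * (N : ℝ)))) * (2 ^ 41 * ((13989287 : ℝ) / 3000000) ^ N) :=
        mul_le_mul_of_nonneg_left hZ3 (Real.exp_pos _).le
    _ = 2 ^ 41 * (Real.exp (-((Real.log 3 - Real.log 2) * ((7 : ℝ) / 10 * (N : ℝ)))) * ((13989287 : ℝ) / 3000000) ^ N) := by ring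
    _ ≤ 2 ^ 41 * (((975 : ℝ) / 1000) * ((1250 : ℝ) / 347)) ^ N := mul_le_mul_of_nonneg_left hunit (by positivity)
    _ = 2 ^ 41 / κ * ((975 : ℝ) / 1000) ^ N * (κ * ((1250 : ℝ) / 347) ^ N) := by
        rw [mul_pow]; field_simp
    _ ≤ 2 ^ 41 / κ * ((975 : ℝ) / 1000) ^ N * pulledBridgeZ 2 N 2 :=
        mul_le_mul_of_nonneg_left hZ2 (by positivity)

/-- **Span concentration under the pulled law at `y = 2`, lower tail, every `N`** (`ℤ²`): there is `C > 0` with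
`Σ_{A ≤ (9/20)N} β_{N,A} 2^A ≤ C · 0.973^N · Z^B_N(2)` for all `N`, i.e. `P^{B,2}_N(span ≤ 0.45 N) ≤ C e^{-0.0273 N}`
(Chernoff towards the force `3/2`: certificate `(4/3)^9 ≤ (0.973 L_2/U_{3/2})^20`, enclosures `driftZ_three_halves_upper`,
`pulledBridgeZ_two_lower_sharp`). [cite: Beaton2015, §2 (B(x,y)), Theorem 1] -/
theorem pulled_two_lowerTail :
    ∃ C : ℝ, 0 < C ∧ ∀ N : ℕ,
      ∑ A ∈ (Finset.range (N + 1)).filter (fun A : ℕ => (A : ℝ) ≤ (9 : ℝ) / 20 * (N : ℝ)),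
          ((brSpan 2 N (A : ℤ)).card : ℝ) * (2 : ℝ) ^ A ≤
        C * ((973 : ℝ) / 1000) ^ N * pulledBridgeZ 2 N 2 := by
  obtain ⟨κ, hκ, hlow⟩ := pulledBridgeZ_two_lower_sharp
  refine ⟨2 ^ 41 / κ, by positivity, fun N => ?_⟩
  have hts : Real.log ((3 : ℝ) / 2) ≤ Real.log 2 := Real.log_le_log (by norm_num) (by norm_num)
  have h1 := ExpTilt.sum_filter_le_le (Finset.range (N + 1)) (w := fun A : ℕ => ((brSpan 2 N (A : ℤ)).card : ℝ))
    (fun _ _ => Nat.cast_nonneg _) (fun A : ℕ => (A : ℝ)) hts ((9 : ℝ) / 20 * (N : ℝ))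
  rw [← pulledBridgeZ_exp_eq_tiltZ, Real.exp_log (by norm_num : (0 : ℝ) < (3 : ℝ) / 2)] at h1
  rw [pulledMass_eq_sum_exp N (by norm_num : (0 : ℝ) < 2)]
  refine h1.trans ?_
  have hZ32 : pulledBridgeZ 2 N ((3 : ℝ) / 2) ≤ 2 ^ 41 * ((18470750 : ℝ) / 6000000) ^ N :=
    (pulledBridgeZ_le_driftZ 2 N (by norm_num)).trans (driftZ_three_halves_upper N)
  have hZ2 := hlow N
  -- the certificate: 9·(log 2 − log(3/2)) ≤ 20·(log(ρ L₂) − log U_{3/2})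
  have hc : (9 : ℝ) * (Real.log 2 - Real.log ((3 : ℝ) / 2)) ≤
      20 * (Real.log (((973 : ℝ) / 1000) * ((1250 : ℝ) / 347)) - Real.log ((18470750 : ℝ) / 6000000)) := by
    exact_mod_cast log_cert_lower 9 20 (x := (3 : ℝ) / 2) (y₀ := 2) (L₀ := ((973 : ℝ) / 1000) * ((1250 : ℝ) / 347))
      (Ux := ((18470750 : ℝ) / 6000000)) (by norm_num) (by norm_num) (by norm_num) (by norm_num) (by norm_num)
  have hunit : Real.exp ((Real.log 2 - Real.log ((3 : ℝ) / 2)) * ((9 : ℝ) / 20 * (N : ℝ))) * ((18470750 : ℝ) / 6000000) ^ N ≤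
      (((973 : ℝ) / 1000) * ((1250 : ℝ) / 347)) ^ N := by
    rw [← Real.exp_log (by norm_num : (0 : ℝ) < ((18470750 : ℝ) / 6000000)), ← Real.exp_nat_mul, ← Real.exp_add,
      ← Real.exp_log (by norm_num : (0 : ℝ) < ((973 : ℝ) / 1000) * ((1250 : ℝ) / 347)), ← Real.exp_nat_mul, Real.exp_le_exp]
    have hN : (0 : ℝ) ≤ N := Nat.cast_nonneg N
    nlinarith
  calc Real.exp ((Real.log 2 - Real.log ((3 : ℝ) / 2)) * ((9 : ℝ) / 20 * (N : ℝ))) * pulledBridgeZ 2 N ((3 : ℝ) / 2)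
      ≤ Real.exp ((Real.log 2 - Real.log ((3 : ℝ) / 2)) * ((9 : ℝ) / 20 * (N : ℝ))) * (2 ^ 41 * ((18470750 : ℝ) / 6000000) ^ N) :=
        mul_le_mul_of_nonneg_left hZ32 (Real.exp_pos _).le
    _ = 2 ^ 41 * (Real.exp ((Real.log 2 - Real.log ((3 : ℝ) / 2)) * ((9 : ℝ) / 20 * (N : ℝ))) * ((18470750 : ℝ) / 6000000) ^ N) := by ring
    _ ≤ 2 ^ 41 * (((973 : ℝ) / 1000) * ((1250 : ℝ) / 347)) ^ N := mul_le_mul_of_nonneg_left hunit (by positivity)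
    _ = 2 ^ 41 / κ * ((973 : ℝ) / 1000) ^ N * (κ * ((1250 : ℝ) / 347) ^ N) := by
        rw [mul_pow]; field_simp
    _ ≤ 2 ^ 41 / κ * ((973 : ℝ) / 1000) ^ N * pulledBridgeZ 2 N 2 :=
        mul_le_mul_of_nonneg_left hZ2 (by positivity)

end Literature.Probability.RandomPlanarGeometry.SAW.Zd
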